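import Mathlib.MeasureTheory.Measure.Haar.NormedSpace
import Mathlib.MeasureTheory.Measure.Lebesgue.EqHaar
import Mathlib.LinearAlgebra.Matrix.ToLin
import HarnessLib

/-!
# Route `SwapVirialDeficit` (YangMills): THE CONFORMAL BASE SUBSTITUTION `p ↦ p″ = M·p`, `M = λI + μJ`, OF THE TIP CAPS — `∫ G(Mp) dp = (λ²+μ²)⁻¹ ∫ G`, `h(Mp) ≤ 3(λ²+μ²)·h(p)`
# (cell ym-idea-1, skeleton ➎ v14, `stub_core_tip`, socket (hCore), step S4 of w2 g61's per-cap assembly on w3 g68's ✓`tipRot_axial` (`p″ = (λx₀ − μy₀, μx₀ + λy₀)`,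
# `μ = (τ⃗·ρ⃗)∕λ`, `det M = λ² + μ² ∈ [1, 7]` on a cap); LEAD ruling (B7) 2026-09-01; LEAD seat ym-line-sfw-p2 g100, free-hands support of ⟨stmt-QuantumFields-24197⟩
# `SwapVirialDeficit.SwapGluedStiffness`)

Mathlib-only; generalises w2 g61's ✓`integral_comp_smul_plane` (`μ = 0`) to the conformal-linear maps of the base plane `ℝ × ℝ`:
* §1 `conformal_normSq` (`|Mp|² = (λ²+μ²)|p|²`), ★ `integral_comp_conformal_plane` (`∫ G(λp₁ − μp₂, μp₁ + λp₂) dp = (λ²+μ²)⁻¹·∫ G`, Bochner, junk-consistent, no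
  measurability), `integral_comp_conformal_plane_weight` (`∫ G(Mp)·W(p) = (λ²+μ²)⁻¹ ∫ G(q)·W(M⁻¹q)`), `lintegral_comp_conformal_plane` (the `ℝ≥0∞` twin, any `G`);
  the determinant is ✓`Matrix.det_fin_two_of` on ✓`Matrix.toLin_finTwoProd_apply`, the measure identity ✓`Measure.map_linearMap_addHaar_eq_smul_addHaar`;
* §2 the gnomonic size `h(p) = p₁²∕(1+p₁²) + p₂²∕(1+p₂²)` under `M`: `normSq_div_le_hFun` (`|p|²∕(1+|p|²) ≤ h`), `hFun_le_normSq`, `hFun_le_two`, and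
  ★ `hFun_conformal_le` — `h(Mp) ≤ 3(λ²+μ²)·h(p)` for `λ²+μ² ≥ 1` (so the Profile currency at `p` is `≤ 21×` that at `p″` on a cap, ✓`profile_antitone`).

HONEST LABEL: generic measure∕algebra bookkeeping; `stub_core_tip`, ⟨24197⟩ ∕ ⟨24194⟩ OPEN; own crux ⟨22884⟩ `LargeFieldMassRefinementTail` OPEN (blocked-on ⟨19935⟩);
the Yang–Mills mass gap is NOT proved; no summit is proved by a line.  THEOREMS ONLY (0 `def`, 0 `sorry`, no instance, no notation), standard axioms.
`--supports stmt-QuantumFields-24197`.  References: [folklore].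
-/

set_option autoImplicit false

noncomputable section

open MeasureTheory Module
open scoped ENNReal

namespace Summit.QuantumFields.YangMills.Theorems.SwapVirialDeficit.SectorLaplace

/-! ## §1 The conformal substitution -/

/-- `|Mp|² = (λ² + μ²)·|p|²` for `Mp = (λp₁ − μp₂, μp₁ + λp₂)`. [folklore] -/
theorem conformal_normSq (lam mu : ℝ) (p : ℝ × ℝ) :
    (lam * p.1 - mu * p.2) ^ 2 + (mu * p.1 + lam * p.2) ^ 2 = (lam ^ 2 + mu ^ 2) * (p.1 ^ 2 + p.2 ^ 2) := by
  ring

/-- The conformal map as `Matrix.toLin` of `!![λ, −μ; μ, λ]` in the standard basis of `ℝ × ℝ`. [folklore] -/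
theorem toLin_conformal_apply (lam mu : ℝ) (p : ℝ × ℝ) :
    Matrix.toLin (Basis.finTwoProd ℝ) (Basis.finTwoProd ℝ) !![lam, -mu; mu, lam] p = (lam * p.1 - mu * p.2, mu * p.1 + lam * p.2) := by
  rw [Matrix.toLin_finTwoProd_apply]
  exact Prod.ext (by show lam * p.1 + -mu * p.2 = _; ring) (by show mu * p.1 + lam * p.2 = _; ring)

/-- Its determinant is `λ² + μ²`. [folklore] -/
theorem det_toLin_conformal (lam mu : ℝ) :
    LinearMap.det (Matrix.toLin (Basis.finTwoProd ℝ) (Basis.finTwoProd ℝ) !![lam, -mu; mu, lam]) = lam ^ 2 + mu ^ 2 := by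
  rw [LinearMap.det_toLin, Matrix.det_fin_two_of]
  ring

/-- The pushforward of Lebesgue measure on `ℝ × ℝ` under the conformal map is `(λ²+μ²)⁻¹ •` Lebesgue (`λ² + μ² ≠ 0`). [folklore] -/
theorem map_conformal_volume {lam mu : ℝ} (h : 0 < lam ^ 2 + mu ^ 2) :
    Measure.map (fun p : ℝ × ℝ => (lam * p.1 - mu * p.2, mu * p.1 + lam * p.2)) volume =
      ENNReal.ofReal ((lam ^ 2 + mu ^ 2)⁻¹) • (volume : Measure (ℝ × ℝ)) := by
  haveI : (volume : Measure (ℝ × ℝ)).IsAddHaarMeasure := Measure.prod.instIsAddHaarMeasure _ _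
  set f := Matrix.toLin (Basis.finTwoProd ℝ) (Basis.finTwoProd ℝ) !![lam, -mu; mu, lam] with hf
  have hdet : LinearMap.det f = lam ^ 2 + mu ^ 2 := det_toLin_conformal lam mu
  have hdet0 : LinearMap.det f ≠ 0 := by rw [hdet]; exact h.ne'
  have hfun : (fun p : ℝ × ℝ => (lam * p.1 - mu * p.2, mu * p.1 + lam * p.2)) = ⇑f := by
    funext p; exact (toLin_conformal_apply lam mu p).symm
  rw [hfun, Measure.map_linearMap_addHaar_eq_smul_addHaar volume hdet0, hdet, abs_of_pos (inv_pos.2 h)]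

/-- The conformal map as a measurable equivalence of `ℝ × ℝ` (explicit inverse `(λ²+μ²)⁻¹·(λq₁ + μq₂, −μq₁ + λq₂)`). [folklore] -/
theorem exists_measurableEquiv_conformal {lam mu : ℝ} (h : 0 < lam ^ 2 + mu ^ 2) :
    ∃ e : (ℝ × ℝ) ≃ᵐ (ℝ × ℝ), (∀ p, e p = (lam * p.1 - mu * p.2, mu * p.1 + lam * p.2)) ∧
      ∀ q, e.symm q = ((lam ^ 2 + mu ^ 2)⁻¹ * (lam * q.1 + mu * q.2), (lam ^ 2 + mu ^ 2)⁻¹ * (-mu * q.1 + lam * q.2)) := by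
  have hne : lam ^ 2 + mu ^ 2 ≠ 0 := h.ne'
  let e : (ℝ × ℝ) ≃ᵐ (ℝ × ℝ) :=
    { toFun := (fun p : ℝ × ℝ => (lam * p.1 - mu * p.2, mu * p.1 + lam * p.2))
      invFun := (fun q : ℝ × ℝ => ((lam ^ 2 + mu ^ 2)⁻¹ * (lam * q.1 + mu * q.2), (lam ^ 2 + mu ^ 2)⁻¹ * (-mu * q.1 + lam * q.2)))
      left_inv := (by intro p; refine Prod.ext ?_ ?_ <;> simp only <;> field_simp <;> ring)
      right_inv := (by intro q; refine Prod.ext ?_ ?_ <;> simp only <;> field_simp <;> ring)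
      measurable_toFun := (show Measurable (fun p : ℝ × ℝ => (lam * p.1 - mu * p.2, mu * p.1 + lam * p.2)) by fun_prop)
      measurable_invFun := (show Measurable (fun q : ℝ × ℝ =>
        ((lam ^ 2 + mu ^ 2)⁻¹ * (lam * q.1 + mu * q.2), (lam ^ 2 + mu ^ 2)⁻¹ * (-mu * q.1 + lam * q.2))) by fun_prop) }
  exact ⟨e, fun p => rfl, fun q => rfl⟩

/-- ★ §1 **THE CONFORMAL SUBSTITUTION ON THE BASE PLANE**: `∫ G(λp₁ − μp₂, μp₁ + λp₂) dp = (λ²+μ²)⁻¹·∫ G` for `λ² + μ² > 0` (Bochner; junk-consistent, no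
measurability of `G` needed). [folklore] -/
theorem integral_comp_conformal_plane (G : ℝ × ℝ → ℝ) {lam mu : ℝ} (h : 0 < lam ^ 2 + mu ^ 2) :
    ∫ p : ℝ × ℝ, G (lam * p.1 - mu * p.2, mu * p.1 + lam * p.2) = (lam ^ 2 + mu ^ 2)⁻¹ * ∫ q : ℝ × ℝ, G q := by
  obtain ⟨e, he, -⟩ := exists_measurableEquiv_conformal h
  have hfun : (fun p : ℝ × ℝ => (lam * p.1 - mu * p.2, mu * p.1 + lam * p.2)) = ⇑e := by funext p; exact (he p).symm
  calc ∫ p : ℝ × ℝ, G (lam * p.1 - mu * p.2, mu * p.1 + lam * p.2) = ∫ p : ℝ × ℝ, G (e p) := by simp_rw [he]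
    _ = ∫ q, G q ∂(Measure.map e volume) := (integral_map_equiv e G).symm
    _ = ∫ q, G q ∂(ENNReal.ofReal ((lam ^ 2 + mu ^ 2)⁻¹) • (volume : Measure (ℝ × ℝ))) := by rw [← hfun, map_conformal_volume h]
    _ = (lam ^ 2 + mu ^ 2)⁻¹ * ∫ q : ℝ × ℝ, G q := by
        rw [integral_smul_measure, ENNReal.toReal_ofReal (inv_nonneg.2 h.le), smul_eq_mul]

/-- §1 with a weight read at the inverse point: `∫ G(Mp)·W(p) dp = (λ²+μ²)⁻¹·∫ G(q)·W(M⁻¹q) dq`, `M⁻¹q = (λ²+μ²)⁻¹·(λq₁ + μq₂, −μq₁ + λq₂)`. [folklore] -/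
theorem integral_comp_conformal_plane_weight (G W : ℝ × ℝ → ℝ) {lam mu : ℝ} (h : 0 < lam ^ 2 + mu ^ 2) :
    ∫ p : ℝ × ℝ, G (lam * p.1 - mu * p.2, mu * p.1 + lam * p.2) * W p =
      (lam ^ 2 + mu ^ 2)⁻¹ * ∫ q : ℝ × ℝ, G q * W ((lam ^ 2 + mu ^ 2)⁻¹ * (lam * q.1 + mu * q.2), (lam ^ 2 + mu ^ 2)⁻¹ * (-mu * q.1 + lam * q.2)) := by
  have hne : lam ^ 2 + mu ^ 2 ≠ 0 := h.ne'
  have key := integral_comp_conformal_plane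
    (fun q : ℝ × ℝ => G q * W ((lam ^ 2 + mu ^ 2)⁻¹ * (lam * q.1 + mu * q.2), (lam ^ 2 + mu ^ 2)⁻¹ * (-mu * q.1 + lam * q.2))) h
  have e : ∀ p : ℝ × ℝ, (fun q : ℝ × ℝ => G q * W ((lam ^ 2 + mu ^ 2)⁻¹ * (lam * q.1 + mu * q.2), (lam ^ 2 + mu ^ 2)⁻¹ * (-mu * q.1 + lam * q.2)))
      (lam * p.1 - mu * p.2, mu * p.1 + lam * p.2) = G (lam * p.1 - mu * p.2, mu * p.1 + lam * p.2) * W p := by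
    intro p
    simp only
    congr 2
    ext <;> field_simp <;> ring
  simp_rw [e] at key
  exact key

/-- §1 in `ℝ≥0∞`: `∫⁻ G(Mp) dp = ofReal((λ²+μ²)⁻¹)·∫⁻ G` (any `G : ℝ × ℝ → ℝ≥0∞`). [folklore] -/
theorem lintegral_comp_conformal_plane (G : ℝ × ℝ → ℝ≥0∞) {lam mu : ℝ} (h : 0 < lam ^ 2 + mu ^ 2) :
    ∫⁻ p : ℝ × ℝ, G (lam * p.1 - mu * p.2, mu * p.1 + lam * p.2) = ENNReal.ofReal ((lam ^ 2 + mu ^ 2)⁻¹) * ∫⁻ q : ℝ × ℝ, G q := by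
  obtain ⟨e, he, -⟩ := exists_measurableEquiv_conformal h
  have hfun : (fun p : ℝ × ℝ => (lam * p.1 - mu * p.2, mu * p.1 + lam * p.2)) = ⇑e := by funext p; exact (he p).symm
  calc ∫⁻ p : ℝ × ℝ, G (lam * p.1 - mu * p.2, mu * p.1 + lam * p.2) = ∫⁻ p : ℝ × ℝ, G (e p) := by simp_rw [he]
    _ = ∫⁻ q, G q ∂(Measure.map e volume) := (lintegral_map_equiv G e).symm
    _ = ∫⁻ q, G q ∂(ENNReal.ofReal ((lam ^ 2 + mu ^ 2)⁻¹) • (volume : Measure (ℝ × ℝ))) := by rw [← hfun, map_conformal_volume h]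
    _ = ENNReal.ofReal ((lam ^ 2 + mu ^ 2)⁻¹) * ∫⁻ q : ℝ × ℝ, G q := by rw [lintegral_smul_measure, smul_eq_mul]

/-! ## §2 The gnomonic size under the conformal map -/

/-- `|p|²∕(1+|p|²) ≤ h(p) = p₁²∕(1+p₁²) + p₂²∕(1+p₂²)`. [folklore] -/
theorem normSq_div_le_hFun (p : ℝ × ℝ) :
    (p.1 ^ 2 + p.2 ^ 2) / (1 + (p.1 ^ 2 + p.2 ^ 2)) ≤ p.1 ^ 2 / (1 + p.1 ^ 2) + p.2 ^ 2 / (1 + p.2 ^ 2) := by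
  have h1 : p.1 ^ 2 / (1 + (p.1 ^ 2 + p.2 ^ 2)) ≤ p.1 ^ 2 / (1 + p.1 ^ 2) :=
    div_le_div_of_nonneg_left (sq_nonneg _) (by positivity) (by nlinarith [sq_nonneg p.2])
  have h2 : p.2 ^ 2 / (1 + (p.1 ^ 2 + p.2 ^ 2)) ≤ p.2 ^ 2 / (1 + p.2 ^ 2) :=
    div_le_div_of_nonneg_left (sq_nonneg _) (by positivity) (by nlinarith [sq_nonneg p.1])
  rw [add_div]
  exact add_le_add h1 h2

/-- `h(p) ≤ |p|²`. [folklore] -/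
theorem hFun_le_normSq (p : ℝ × ℝ) : p.1 ^ 2 / (1 + p.1 ^ 2) + p.2 ^ 2 / (1 + p.2 ^ 2) ≤ p.1 ^ 2 + p.2 ^ 2 := by
  have h1 : p.1 ^ 2 / (1 + p.1 ^ 2) ≤ p.1 ^ 2 := div_le_self (sq_nonneg _) (by nlinarith [sq_nonneg p.1])
  have h2 : p.2 ^ 2 / (1 + p.2 ^ 2) ≤ p.2 ^ 2 := div_le_self (sq_nonneg _) (by nlinarith [sq_nonneg p.2])
  linarith

/-- `h(p) ≤ 2`. [folklore] -/
theorem hFun_le_two (p : ℝ × ℝ) : p.1 ^ 2 / (1 + p.1 ^ 2) + p.2 ^ 2 / (1 + p.2 ^ 2) ≤ 2 := by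
  have h1 : p.1 ^ 2 / (1 + p.1 ^ 2) ≤ 1 := by rw [div_le_one (by positivity)]; linarith
  have h2 : p.2 ^ 2 / (1 + p.2 ^ 2) ≤ 1 := by rw [div_le_one (by positivity)]; linarith
  linarith

/-- `0 ≤ h(p)`. [folklore] -/
theorem hFun_nonneg (p : ℝ × ℝ) : 0 ≤ p.1 ^ 2 / (1 + p.1 ^ 2) + p.2 ^ 2 / (1 + p.2 ^ 2) := by positivity

/-- ★ §2 **THE GNOMONIC SIZE UNDER THE CONFORMAL MAP**: `h(Mp) ≤ 3(λ²+μ²)·h(p)` for `λ² + μ² ≥ 1`. [folklore] -/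
theorem hFun_conformal_le {lam mu : ℝ} (h : 1 ≤ lam ^ 2 + mu ^ 2) (p : ℝ × ℝ) :
    (lam * p.1 - mu * p.2) ^ 2 / (1 + (lam * p.1 - mu * p.2) ^ 2) + (mu * p.1 + lam * p.2) ^ 2 / (1 + (mu * p.1 + lam * p.2) ^ 2) ≤
      3 * (lam ^ 2 + mu ^ 2) * (p.1 ^ 2 / (1 + p.1 ^ 2) + p.2 ^ 2 / (1 + p.2 ^ 2)) := by
  set c := lam ^ 2 + mu ^ 2 with hc
  set N := p.1 ^ 2 + p.2 ^ 2 with hN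
  have hN0 : 0 ≤ N := by positivity
  have hMsq : (lam * p.1 - mu * p.2) ^ 2 + (mu * p.1 + lam * p.2) ^ 2 = c * N := conformal_normSq lam mu p
  have hlow : N / (1 + N) ≤ p.1 ^ 2 / (1 + p.1 ^ 2) + p.2 ^ 2 / (1 + p.2 ^ 2) := normSq_div_le_hFun p
  rcases le_or_gt N 2 with hsmall | hlarge
  · -- `|p|² ≤ 2`: `h(Mp) ≤ |Mp|² = c|p|² ≤ c·h(p)·(1+|p|²) ≤ 3c·h(p)`
    have hup : (lam * p.1 - mu * p.2) ^ 2 / (1 + (lam * p.1 - mu * p.2) ^ 2) + (mu * p.1 + lam * p.2) ^ 2 / (1 + (mu * p.1 + lam * p.2) ^ 2) ≤ c * N := by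
      rw [← hMsq]; exact hFun_le_normSq (lam * p.1 - mu * p.2, mu * p.1 + lam * p.2)
    have hkey : N ≤ 3 * (N / (1 + N)) := by
      rw [show 3 * (N / (1 + N)) = 3 * N / (1 + N) by ring, le_div_iff₀ (by positivity)]
      nlinarith
    calc _ ≤ c * N := hup
      _ ≤ c * (3 * (N / (1 + N))) := by gcongr
      _ = 3 * c * (N / (1 + N)) := by ring
      _ ≤ 3 * c * (p.1 ^ 2 / (1 + p.1 ^ 2) + p.2 ^ 2 / (1 + p.2 ^ 2)) := by gcongr
  · -- `|p|² > 2`: `h(Mp) ≤ 2 ≤ 3·(2/3) ≤ 3c·h(p)`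
    have h23 : 2 / 3 ≤ N / (1 + N) := by rw [div_le_div_iff₀ (by norm_num) (by positivity)]; nlinarith
    calc _ ≤ 2 := hFun_le_two (lam * p.1 - mu * p.2, mu * p.1 + lam * p.2)
      _ ≤ 3 * c * (2 / 3) := by nlinarith
      _ ≤ 3 * c * (p.1 ^ 2 / (1 + p.1 ^ 2) + p.2 ^ 2 / (1 + p.2 ^ 2)) := by gcongr; exact h23.trans hlow

end Summit.QuantumFields.YangMills.Theorems.SwapVirialDeficit.SectorLaplace

end
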